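import Summits.ValiantsHypothesis.ValiantsHypothesis.Theorems.LacunarySymmetroidMatrixDescartesCensusCUSoundRank
import Summits.ValiantsHypothesis.ValiantsHypothesis.Theorems.LacunarySymmetroidMatrixDescartesCensusChamberTableB
import Summits.ValiantsHypothesis.ValiantsHypothesis.Theorems.LacunarySymmetroidMatrixDescartesCensusChamberSymmetry
import Summits.ValiantsHypothesis.ValiantsHypothesis.Theorems.LacunarySymmetroidMatrixDescartesCensusLorentzRows

/-!
# `MatrixDescartes` census — soundness of the chamber-uniform checker, part 6: MAIN THEOREMS

HONEST FRAMING.  Object-search cell `pub-symmetroid`; door-A item `DoorA26 = PosRootLawAt 2 6 19`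
(stmt-ValiantsHypothesis-19979; OPEN, typed, never asserted).  The closing file of the CHAMBER-UNIFORM CHECKED CHECKER
(`…CensusCUCheck`, soundness parts `…CensusCUSound{Forms,Model,Certs,Rank}`):

* `CU.model_of_twenty` — a hypothetical twenty on a support yields a `CU.Model` (the `V = 20` model of `…CensusV20SoundTwenty`
  plus the rank rows `M4 = 0` and the T rows);
* `CU.ordOK_of_chamber` — on a support of the chamber of `σ` the order `CU.ofSigma σ` passes the `V20` order check;
* **`CU.posRootLawOn_of_checkChamber`** — if `CU.checkChamber (CU.ofSigma σ) cpos cneg = true` then EVERY support `d` of the chamber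
  of `σ` (`StrictMono (pairSum ∘ σ)`) satisfies `PosRootLawOn 2 6 19 d` (= `ζ(2,6; d) ≤ 19`) — verbatim the shape of the landed
  chamber rows `Census.doorA26_on_chamber<n>` and of the instances of the census line's `Stmt.stub_easyChambers`;
* **`CU.doorA26_on_chambers_of_checkTable`** — the same over a TABLE of chamber ids of `Census.chamber` (`…CensusChamberTableB`),
  one `decide +kernel` per table; and `CU.doorA26_on_mirrors` — mirror chambers by `Census.chamberRow_mirror` after a decidable check.

So a certified chamber costs one table line instead of 10–110 files.  A certified chamber asserts the door on its cone only; nothing here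
bears on `V = 19`, on `DoorA26` itself (OPEN), on `MatrixDescartes` (stmt-ValiantsHypothesis-18050) or on `VP ≠ VNP`.

[folklore] Certificate-checker soundness; elementary.
-/

-- the D-0017 layout repeats a namespace component (single-conjunct summit); the `dupNamespace` linter flags it; name mandated.
set_option linter.dupNamespace false

namespace Summit.ValiantsHypothesis.ValiantsHypothesis.Theorems.LacunarySymmetroidMatrixDescartes.Census.CU

open V20 (Atom Term allAtoms qA cA pval tval aval bv qv fin6 Epos psum ordOK pdet dfun)
open Polynomial

/-! ## A twenty yields a model -/

/-- **A hypothetical twenty on a checked support yields a `CU.Model`** for the sign of its lowest coefficient. [folklore] -/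
theorem model_of_twenty {dl : List ℕ} {ord : List Atom} {S : Fin 6 → Matrix (Fin 2) (Fin 2) ℝ} (h : ordOK dl ord = true)
    (hS : ∀ l, (S l).IsSymm) (h20 : 20 ≤ ((pdet dl S).roots.toFinset.filter (fun t => 0 < t)).card) :
    ∃ x : ℕ → ℝ, Model dl ord (decide (0 < (pdet dl S).coeff (Epos dl ord 0))) x (aval S) := by
  obtain ⟨x, M⟩ := V20.model_of_twenty h hS h20
  refine ⟨x, M, fun r c _ _ hr6 hc6 => pval_m4Poly S hr6 hc6, ?_⟩
  intro i j k _ _ _ hij hjk hik hqi hqj hqk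
  rw [V20.aval_qA] at hqi hqj hqk
  rw [V20.aval_cA S hik, V20.aval_cA S hij, V20.aval_cA S hjk, V20.aval_qA]
  unfold qv at hqi hqj hqk
  have hM := gram_master_identity (S (fin6 i) 0 0) (S (fin6 i) 0 1) (S (fin6 i) 1 1) (S (fin6 j) 0 0) (S (fin6 j) 0 1)
    (S (fin6 j) 1 1) (S (fin6 k) 0 0) (S (fin6 k) 0 1) (S (fin6 k) 1 1)
  have h1 := four_det_mul_det_le_polarDet_sq (S (fin6 i) 0 0) (S (fin6 i) 0 1) (S (fin6 i) 1 1) (S (fin6 j) 0 0) (S (fin6 j) 0 1)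
    (S (fin6 j) 1 1) hqi
  have h2 := four_det_mul_det_le_polarDet_sq (S (fin6 j) 0 0) (S (fin6 j) 0 1) (S (fin6 j) 1 1) (S (fin6 k) 0 0) (S (fin6 k) 0 1)
    (S (fin6 k) 1 1) hqj
  have h1' : 4 * |S (fin6 i) 0 0 * S (fin6 i) 1 1 - S (fin6 i) 0 1 ^ 2| * (S (fin6 j) 0 0 * S (fin6 j) 1 1 - S (fin6 j) 0 1 ^ 2)
      ≤ (S (fin6 i) 0 0 * S (fin6 j) 1 1 + S (fin6 i) 1 1 * S (fin6 j) 0 0 - 2 * (S (fin6 i) 0 1 * S (fin6 j) 0 1)) ^ 2 := by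
    rw [abs_of_pos hqi]; exact h1
  have h2' : 4 * (S (fin6 j) 0 0 * S (fin6 j) 1 1 - S (fin6 j) 0 1 ^ 2) * |S (fin6 k) 0 0 * S (fin6 k) 1 1 - S (fin6 k) 0 1 ^ 2|
      ≤ (S (fin6 j) 0 0 * S (fin6 k) 1 1 + S (fin6 j) 1 1 * S (fin6 k) 0 0 - 2 * (S (fin6 j) 0 1 * S (fin6 k) 0 1)) ^ 2 := by
    rw [abs_of_pos hqk]; exact h2
  have := trow_long_long hM hqj h1' h2'
  simpa only [bv, qv] using this

/-! ## The order of a chamber passes the `V20` order check -/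

/-- `dfun (dlist d) = d`. [folklore] -/
theorem dfun_dlist (d : Fin 6 → ℕ) : dfun (dlist d) = d := by
  funext i; fin_cases i <;> rfl

/-- The pair sum of the `ofSigma` atom at `t`. [folklore] -/
theorem psum_ofSigma (σ : Fin 21 → Fin 6 × Fin 6) (d : Fin 6 → ℕ) (t : Fin 21) :
    psum (dlist d) (((σ t).1 : ℕ), ((σ t).2 : ℕ)) = d (σ t).1 + d (σ t).2 := by
  unfold psum
  rw [getD_dlist d (σ t).1.isLt, getD_dlist d (σ t).2.isLt]

/-- **On a support of the chamber of `σ`, the order `ofSigma σ` passes the `V20` order check.** [folklore] -/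
theorem ordOK_of_chamber (σ : Fin 21 → Fin 6 × Fin 6) (hA : ordAtomsOK (ofSigma σ) = true) (d : Fin 6 → ℕ)
    (hd : StrictMono ((fun p : Fin 6 × Fin 6 => d p.1 + d p.2) ∘ σ)) : ordOK (dlist d) (ofSigma σ) = true := by
  obtain ⟨hlen, h1, h2⟩ := ordAtomsOK_spec hA
  unfold ordOK
  simp only [Bool.and_eq_true, decide_eq_true_eq]
  refine ⟨⟨⟨⟨rfl, hlen⟩, h1⟩, h2⟩, ?_⟩
  unfold ofSigma
  rw [List.pairwise_ofFn]
  intro i j hij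
  rw [psum_ofSigma, psum_ofSigma]
  exact hd hij

/-! ## Main theorems -/

/-- **SOUNDNESS OF THE CHAMBER-UNIFORM CHECKER.**  If both orientations of the chamber order `ofSigma σ` carry accepted certificates,
then every support of the chamber of `σ` satisfies `ζ(2,6; d) ≤ 19`. [folklore] -/
theorem posRootLawOn_of_checkChamber (σ : Fin 21 → Fin 6 × Fin 6) (cpos cneg : Cert)
    (h : checkChamber (ofSigma σ) cpos cneg = true) (d : Fin 6 → ℕ)
    (hd : StrictMono ((fun p : Fin 6 × Fin 6 => d p.1 + d p.2) ∘ σ)) : PosRootLawOn 2 6 19 d := by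
  unfold checkChamber at h
  simp only [Bool.and_eq_true] at h
  obtain ⟨⟨hA, hp⟩, hn⟩ := h
  have hord := ordOK_of_chamber σ hA d hd
  intro S hS
  by_contra hlt
  have h20 : 20 ≤ ((pdet (dlist d) S).roots.toFinset.filter (fun t => 0 < t)).card := by
    unfold pdet; rw [dfun_dlist]; push Not at hlt; exact hlt
  obtain ⟨x, M⟩ := model_of_twenty hord hS h20
  have hctx : ∀ G ∈ baseCtx (ofSigma σ), 0 ≤ G.ev d := by
    intro G hG
    unfold baseCtx at hG
    rw [List.mem_map] at hG
    obtain ⟨i, hi, rfl⟩ := hG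
    rw [List.mem_range] at hi
    have := one_le_pairForm d hA M.toV20 rfl (p := (i, i + 1)) ⟨Nat.lt_succ_self i, by omega⟩
    omega
  by_cases hs : 0 < (pdet (dlist d) S).coeff (Epos (dlist d) (ofSigma σ) 0)
  · rw [show decide (0 < (pdet (dlist d) S).coeff (Epos (dlist d) (ofSigma σ) 0)) = true by simp [hs]] at M
    exact certOK_sound d hA M cpos _ [] hctx (by simp) hp
  · rw [show decide (0 < (pdet (dlist d) S).coeff (Epos (dlist d) (ofSigma σ) 0)) = false by simp [hs]] at M
    exact certOK_sound d hA M cneg _ [] hctx (by simp) hn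

/-- A table of chamber certificates: chamber id of `Census.chamber`, certificate for `s = +`, certificate for `s = −`. [folklore] -/
abbrev Table := List (ℕ × Cert × Cert)

/-- Check a table against the chamber table of record `Census.chamber`. [folklore] -/
noncomputable def checkTable (T : Table) : Bool := T.all fun e => checkChamber (ofSigma (chamber e.1)) e.2.1 e.2.2

/-- **Every chamber of an accepted table carries the door-A row**: for `n` listed, every support of chamber `n` satisfies
`ζ(2,6; d) ≤ 19` — the instance of `Stmt.stub_easyChambers` of the census line at `n`. [folklore] -/
theorem doorA26_on_chambers_of_checkTable (T : Table) (h : checkTable T = true) :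
    ∀ n ∈ T.map Prod.fst, ∀ d : Fin 6 → ℕ,
      StrictMono ((fun p : Fin 6 × Fin 6 => d p.1 + d p.2) ∘ chamber n) → PosRootLawOn 2 6 19 d := by
  intro n hn d hd
  rw [List.mem_map] at hn
  obtain ⟨e, he, rfl⟩ := hn
  unfold checkTable at h
  rw [List.all_eq_true] at h
  exact posRootLawOn_of_checkChamber (chamber e.1) e.2.1 e.2.2 (h e he) d hd

/-- The mirror order: positions reversed, letters relabelled `i ↦ 5 − i`, pair components swapped (as in `Census.chamberRow_mirror`). [folklore] -/
def mirrorSigma (σ : Fin 21 → Fin 6 × Fin 6) : Fin 21 → Fin 6 × Fin 6 :=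
  fun t => ((σ (Fin.rev t)).2.rev, (σ (Fin.rev t)).1.rev)

/-- Check that the listed pairs `(n, m)` are mirror pairs of the chamber table. [folklore] -/
noncomputable def mirrorPairsOK (pairs : List (ℕ × ℕ)) : Bool := pairs.all fun p => decide (mirrorSigma (chamber p.1) = chamber p.2)

/-- **Mirror chambers**: if the rows hold for the chambers `n` of the listed mirror pairs `(n, m)`, they hold for the chambers `m`. [folklore] -/
theorem doorA26_on_mirrors (pairs : List (ℕ × ℕ)) (hmir : mirrorPairsOK pairs = true)
    (hrows : ∀ n ∈ pairs.map Prod.fst, ∀ d : Fin 6 → ℕ,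
      StrictMono ((fun p : Fin 6 × Fin 6 => d p.1 + d p.2) ∘ chamber n) → PosRootLawOn 2 6 19 d) :
    ∀ m ∈ pairs.map Prod.snd, ∀ d : Fin 6 → ℕ,
      StrictMono ((fun p : Fin 6 × Fin 6 => d p.1 + d p.2) ∘ chamber m) → PosRootLawOn 2 6 19 d := by
  intro m hm d hd
  rw [List.mem_map] at hm
  obtain ⟨p, hp, rfl⟩ := hm
  unfold mirrorPairsOK at hmir
  rw [List.all_eq_true] at hmir
  have he : mirrorSigma (chamber p.1) = chamber p.2 := of_decide_eq_true (hmir p hp)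
  refine chamberRow_mirror (chamber p.1) (hrows p.1 (List.mem_map.2 ⟨p, hp, rfl⟩)) d ?_
  have : (fun t : Fin 21 => ((chamber p.1 (Fin.rev t)).2.rev, (chamber p.1 (Fin.rev t)).1.rev)) = chamber p.2 := he
  rw [this]; exact hd

end Summit.ValiantsHypothesis.ValiantsHypothesis.Theorems.LacunarySymmetroidMatrixDescartes.Census.CU
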